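import Summits.Ventures.CertifiedManyBodySolver.Downfold.EmeryFermiSurfaceHarmonics
import HarnessLib

/-!
# THE `t_pp″` BUDGET LINE OF THE WORKED EXAMPLE: for EVERY member of box #18's typed σ companion
# `emeryBoxLa214v123` (La₂CuO₄), a same-sublattice oxygen hopping of the printed magnitude moves the exact
# Fermi-surface shape by a CERTIFIED, ENERGY-FREE amount (INFL-3to1-B §B.99; kernel `EmeryFermiSurfaceHarmonics`)

Venture CertifiedManyBodySolver, cell `pub/hubbard-downfold` (stage S1), seat hubbard-downfold-mod-4 (technique B,
g44); namespace `Summit.Ventures.CertifiedManyBodySolver.Downfold.Emery`. Everything PROVED (0 sorry, no certificate: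
closed-form bound `abs_fsM5_div_fsN5_le` + `norm_num`).

OBJECT. Box #18 (router/BOXES/La2CuO4-family.md §DFT-3b) prints, beside the σ quartet `(Δ_pd, t_pd, t_pp, t_pp′)`, a
same-sublattice O–O hopping `t_pp″` («(⊥, |d| = a)»: atomic-like construction `c` −0.027/−0.028 eV, frozen-window
construction `p` +0.141/+0.140 eV) which the quartet cannot represent («NOT representable ⇒ MODEL-FORM flag»). By
`EmeryFermiSurfaceHarmonics` §3 the σ + `t_pp″` model's constant-energy contours are EXACTLY `t–t′–t″` contours with
`t″/t′ = fsM5/fsN5` and `|t″/t′| ≤ |t_pp″|/(2(t_pp + t_pp′))` at every energy `ε ≥ 0` with `t_pp′ε ≤ t_pd²`.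
On the typed box (`Δ ∈ [1.7, 4.0]`, `t_pd ∈ [1.29, 1.52]`, `t_pp ∈ [0.46, 0.66]`, `t_pp′ ∈ [0.12, 0.15]` eV;
`2(t_pp + t_pp′) ≥ 1.16`; every σ Fermi energy of the box lies in `[0, 487/200]` ⊂ `[0, 10]`,
`la214Box_fermiEnergyOf_le_ceiling`):
* `la214Box_tpp2_ratio_small` — `|t_pp″| ≤ 0.03` (the atomic-like magnitude): **`|t″/t′| ≤ 3/116 < 0.026`** and the
  nesting-fold shift `|2t″/t′| ≤ 3/58 < 0.052` (`…_fold_small`), for every member, every such `t_pp″`, every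
  `ε ∈ [0, 10]`;
* `la214Box_tpp2_ratio_large` — `|t_pp″| ≤ 0.15` (≥ every printed magnitude): `|t″/t′| ≤ 15/116 < 0.13`;
* `la214Box_tpp2_cuprateSign` — a NEGATIVE `t_pp″` (direct `ppπ` overlap, the `c` construction's sign) gives the
  cuprate sign `t″ > 0` for every member at every `ε ∈ [0, 10]`; `la214Box_fsN5_pos` — the `xy` weight stays
  positive (`t′ < 0`, cuprate-like) for `|t_pp″| ≤ 0.15`.
READING (value-free): dropping the atomic-like construction's `t_pp″` changes the exact Fermi-surface `t″/t′` of ANY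
member by at most 0.026 in ratio (the quartet has `t″ ≡ 0`) and the nesting-line `t′_eff/t` by at most 5.2 % of
`|t′/t|` (≤ 0.016 on the box's `|t′/t| ≤ 0.30`) — the «c-set may drop it» clause of the box as a theorem; the
frozen-window `p` rows (`t_pp′ < 0`) are outside the box's sign convention and are read at float level in §B.99.

WHAT THIS IS NOT: statements about La₂CuO₄ — the typed box is a SCREENING-GRADE S1 object; `U = 0` one-body
kinematics; not the Fermi ENERGY of the `t_pp″` model (the bound is energy-free on `[0, 10]` eV); no box edit.
-/

noncomputable section

namespace Summit.Ventures.CertifiedManyBodySolver.Downfold.Emery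

open Real Set

/-- The regime hypotheses of `abs_fsM5_div_fsN5_le` hold on box #18 for `|c₂| ≤ 3/20` and `ε ∈ [0, 10]`:
`t_pd ≠ 0`, `0 ≤ c`, `0 < c + t_pp`, `cε ≤ t_pd²`, `c² + c₂² ≤ t_pp²`. [folklore] -/
theorem la214Box_tpp2_regime {Δ a b c c₂ ε : ℝ} (ha : a ∈ Icc ((129 : ℝ) / 100) ((38 : ℝ) / 25))
    (hb : b ∈ Icc ((23 : ℝ) / 50) ((33 : ℝ) / 50)) (hc : c ∈ Icc ((3 : ℝ) / 25) ((3 : ℝ) / 20))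
    (hc₂ : |c₂| ≤ (3 : ℝ) / 20) (hε : ε ∈ Icc (0 : ℝ) 10) (_hΔ : Δ ∈ Icc ((17 : ℝ) / 10) (4 : ℝ)) :
    a ≠ 0 ∧ 0 ≤ c ∧ 0 < c + b ∧ c * ε ≤ a ^ 2 ∧ c ^ 2 + c₂ ^ 2 ≤ b ^ 2 := by
  obtain ⟨ha1, ha2⟩ := ha; obtain ⟨hb1, hb2⟩ := hb; obtain ⟨hc1, hc2⟩ := hc; obtain ⟨he1, he2⟩ := hε
  have hc₂' : c₂ ^ 2 ≤ ((3 : ℝ) / 20) ^ 2 := by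
    rw [← sq_abs]; exact pow_le_pow_left₀ (abs_nonneg _) hc₂ 2
  refine ⟨by intro h; rw [h] at ha1; norm_num at ha1, by linarith, by linarith, ?_, ?_⟩
  · nlinarith
  · nlinarith

/-- **THE `t_pp″` BUDGET LINE (atomic-like magnitude).** For every member of `emeryBoxLa214v123` (raw
coordinates), every same-sublattice hopping `|t_pp″| ≤ 3/100` eV and every energy `ε ∈ [0, 10]` eV the exact
one-band ratio of the σ + `t_pp″` model's constant-energy contour obeys `|t″/t′| = |fsM5/fsN5| ≤ 3/116`.
[folklore] -/
theorem la214Box_tpp2_ratio_small {Δ a b c c₂ ε : ℝ} (hΔ : Δ ∈ Icc ((17 : ℝ) / 10) (4 : ℝ))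
    (ha : a ∈ Icc ((129 : ℝ) / 100) ((38 : ℝ) / 25)) (hb : b ∈ Icc ((23 : ℝ) / 50) ((33 : ℝ) / 50))
    (hc : c ∈ Icc ((3 : ℝ) / 25) ((3 : ℝ) / 20)) (hc₂ : |c₂| ≤ (3 : ℝ) / 100) (hε : ε ∈ Icc (0 : ℝ) 10) :
    |fsM5 a c c₂ ε / fsN5 a b c c₂ ε| ≤ (3 : ℝ) / 116 := by
  obtain ⟨h1, h2, h3, h4, h5⟩ :=
    la214Box_tpp2_regime ha hb hc (le_trans hc₂ (by norm_num)) hε hΔ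
  have hb1 := hb.1; have hc1 := hc.1
  have hbound := abs_fsM5_div_fsN5_le h1 h2 h3 hε.1 h4 h5
  have hden : (29 : ℝ) / 25 ≤ 2 * (c + b) := by linarith
  calc |fsM5 a c c₂ ε / fsN5 a b c c₂ ε| ≤ |c₂| / (2 * (c + b)) := hbound
    _ ≤ ((3 : ℝ) / 100) / ((29 : ℝ) / 25) := by
        apply div_le_div₀ (by norm_num) hc₂ (by norm_num) hden
    _ = (3 : ℝ) / 116 := by norm_num

/-- **The nesting-fold shift (atomic-like magnitude).** Same hypotheses: the relative shift of the nesting-line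
`t′_eff = t′ − 2t″` is `|2t″/t′| ≤ 3/58`. [folklore] -/
theorem la214Box_tpp2_fold_small {Δ a b c c₂ ε : ℝ} (hΔ : Δ ∈ Icc ((17 : ℝ) / 10) (4 : ℝ))
    (ha : a ∈ Icc ((129 : ℝ) / 100) ((38 : ℝ) / 25)) (hb : b ∈ Icc ((23 : ℝ) / 50) ((33 : ℝ) / 50))
    (hc : c ∈ Icc ((3 : ℝ) / 25) ((3 : ℝ) / 20)) (hc₂ : |c₂| ≤ (3 : ℝ) / 100) (hε : ε ∈ Icc (0 : ℝ) 10) :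
    |2 * (fsM5 a c c₂ ε / fsN5 a b c c₂ ε)| ≤ (3 : ℝ) / 58 := by
  have h := la214Box_tpp2_ratio_small hΔ ha hb hc hc₂ hε
  rw [abs_mul, abs_two]
  linarith

/-- **THE `t_pp″` BUDGET LINE (any printed magnitude).** For every member, every `|t_pp″| ≤ 3/20` eV (≥ the
frozen-window construction's +0.141) and every `ε ∈ [0, 10]`: `|t″/t′| ≤ 15/116`. [folklore] -/
theorem la214Box_tpp2_ratio_large {Δ a b c c₂ ε : ℝ} (hΔ : Δ ∈ Icc ((17 : ℝ) / 10) (4 : ℝ))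
    (ha : a ∈ Icc ((129 : ℝ) / 100) ((38 : ℝ) / 25)) (hb : b ∈ Icc ((23 : ℝ) / 50) ((33 : ℝ) / 50))
    (hc : c ∈ Icc ((3 : ℝ) / 25) ((3 : ℝ) / 20)) (hc₂ : |c₂| ≤ (3 : ℝ) / 20) (hε : ε ∈ Icc (0 : ℝ) 10) :
    |fsM5 a c c₂ ε / fsN5 a b c c₂ ε| ≤ (15 : ℝ) / 116 := by
  obtain ⟨h1, h2, h3, h4, h5⟩ := la214Box_tpp2_regime ha hb hc hc₂ hε hΔ
  have hb1 := hb.1; have hc1 := hc.1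
  have hbound := abs_fsM5_div_fsN5_le h1 h2 h3 hε.1 h4 h5
  have hden : (29 : ℝ) / 25 ≤ 2 * (c + b) := by linarith
  calc |fsM5 a c c₂ ε / fsN5 a b c c₂ ε| ≤ |c₂| / (2 * (c + b)) := hbound
    _ ≤ ((3 : ℝ) / 20) / ((29 : ℝ) / 25) := by
        apply div_le_div₀ (by norm_num) hc₂ (by norm_num) hden
    _ = (15 : ℝ) / 116 := by norm_num

/-- **The `xy` weight stays positive** (`t′ = −fsN5 < 0`, cuprate-like) for every member, every `|t_pp″| ≤ 3/20`
and every `ε ∈ [0, 10]`. [folklore] -/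
theorem la214Box_fsN5_pos {Δ a b c c₂ ε : ℝ} (hΔ : Δ ∈ Icc ((17 : ℝ) / 10) (4 : ℝ))
    (ha : a ∈ Icc ((129 : ℝ) / 100) ((38 : ℝ) / 25)) (hb : b ∈ Icc ((23 : ℝ) / 50) ((33 : ℝ) / 50))
    (hc : c ∈ Icc ((3 : ℝ) / 25) ((3 : ℝ) / 20)) (hc₂ : |c₂| ≤ (3 : ℝ) / 20) (hε : ε ∈ Icc (0 : ℝ) 10) :
    0 < fsN5 a b c c₂ ε := by
  obtain ⟨h1, _, h3, _, h5⟩ := la214Box_tpp2_regime ha hb hc hc₂ hε hΔ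
  exact fsN5_pos h1 h3 hε.1 h5

/-- **THE SIGN LINE.** For every member, every NEGATIVE same-sublattice hopping `t_pp″ < 0` (direct `ppπ`
overlap; the atomic-like construction prints −0.027 eV) and every `ε ∈ [0, 10]`, the exact one-band `t″` of the
contour is POSITIVE — the cuprate sign, opposite to `t′` (`fsTpp5_pos_iff`). [folklore] -/
theorem la214Box_tpp2_cuprateSign {Δ a c c₂ ε : ℝ} (_hΔ : Δ ∈ Icc ((17 : ℝ) / 10) (4 : ℝ))
    (ha : a ∈ Icc ((129 : ℝ) / 100) ((38 : ℝ) / 25)) (hc : c ∈ Icc ((3 : ℝ) / 25) ((3 : ℝ) / 20))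
    (hc₂ : c₂ < 0) (hε : ε ∈ Icc (0 : ℝ) 10) : 0 < fsTpp5 a c c₂ ε := by
  obtain ⟨ha1, _⟩ := ha; obtain ⟨_, hc2⟩ := hc; obtain ⟨_, he2⟩ := hε
  have hce : c * ε < a ^ 2 := by nlinarith
  exact (fsTpp5_pos_iff hce).2 hc₂

/-- **THE ATOMIC-LIKE ROW AS A POINT** (La₂CuO₄ `c` construction on the experimental cell, §DFT-3b: `t_pd = 1.391`,
`t_pp = 0.660`, `t_pp′ = 0.136`, `t_pp″ = −0.027` eV): at every `ε ∈ [0, 10]` the exact `t″/t′` of its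
σ + `t_pp″` contour satisfies `|t″/t′| ≤ 27/1592 < 0.017` and `t″ > 0`. [folklore] -/
theorem la214DFTc_tpp2_point {ε : ℝ} (hε : ε ∈ Icc (0 : ℝ) 10) :
    |fsM5 ((1391 : ℝ) / 1000) ((17 : ℝ) / 125) ((-27 : ℝ) / 1000) ε /
        fsN5 ((1391 : ℝ) / 1000) ((33 : ℝ) / 50) ((17 : ℝ) / 125) ((-27 : ℝ) / 1000) ε| ≤ (27 : ℝ) / 1592 ∧
      0 < fsTpp5 ((1391 : ℝ) / 1000) ((17 : ℝ) / 125) ((-27 : ℝ) / 1000) ε := by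
  obtain ⟨he1, he2⟩ := hε
  have hce : (17 : ℝ) / 125 * ε ≤ ((1391 : ℝ) / 1000) ^ 2 := by nlinarith
  have hb := abs_fsM5_div_fsN5_le (tpd := (1391 : ℝ) / 1000) (tpp := (33 : ℝ) / 50) (c := (17 : ℝ) / 125)
    (c₂ := (-27 : ℝ) / 1000) (by norm_num) (by norm_num) (by norm_num) he1 hce (by norm_num)
  refine ⟨le_trans hb (by rw [abs_of_neg (by norm_num)]; norm_num), ?_⟩
  exact (fsTpp5_pos_iff (by nlinarith)).2 (by norm_num)

end Summit.Ventures.CertifiedManyBodySolver.Downfold.Emery
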